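import Mathlib
import Literature.Computability.AlgebraicComplexity.NewtonPolygonTauProductBounds
import Summits.ValiantsHypothesis.ValiantsHypothesis.Theorems.NewtonUnitEquationsDissociatedUniformTotalsLaw
import Summits.ValiantsHypothesis.ValiantsHypothesis.Theorems.NewtonUnitEquationsDissociatedUniformTotalsLawUnion
import Summits.ValiantsHypothesis.ValiantsHypothesis.Theorems.NewtonUnitEquationsDissociatedUniformTotalsLawUnionCosets
import Summits.ValiantsHypothesis.ValiantsHypothesis.Theorems.NewtonUnitEquationsDissociatedUniformTotalsLawBoxWindows
import HarnessLib

/-!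
# Crux `NewtonUnitEquations.DissociatedUniform` (stmt-ValiantsHypothesis-5905): the `n = 3` totals law — DIGIT BOXES in `ℤ/q`
# (rank-two Bohr boxes `{t + iN + j : i < m₁, j < m₂}`: `#vert conv U_s(Z) = O(q log q)` pointwise, arbitrary pairs)

Memo `Cruxes/DissociatedUniform/NOTES-t1g17.md` §4.  The literal (Q**) label group is cyclic; the box stratum of `…TotalsLawBoxUnion`
(product groups) has the following `ℤ/q` form.  A DIGIT BOX (two-digit window, rank-two Bohr box) is
`Z = {t + i·N + j : i < m₁, j < m₂} ⊂ ℤ/q` (`digitBox`), "fitting" when `m₂ ≤ N` and `m₁·N ≤ q` — an arithmetic progression (step `N`) of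
`m₁` intervals of length `m₂`.  The runs bound `…IntervalUnionLinearRuns` gives `24·m₁·q` for such a set; here:
* `unionPts_digitBox_eq` — `U_s(Z) = ⋃_x (a x + b''[box_x])` (no fitting hypothesis needed) for the doubly indexed family `b'' (n₁, n₂) = b (n₁N + n₂)` with box
  windows of shape `m₁ × m₂` and corners `(u / N, u mod N)`, `u = (s − x − t') .val` (`t'` the reflected offset), so corners
  `< (q/N + 1, N)`;
* by `…BoxWindows.ncard_extremePoints_boxWindows_le`: **`unionVert_digitBox_le`**: for a fitting digit box,
  `#vert conv U_s(Z) ≤ 16K(q + m₁m₂((q/N+1)/m₁ + 1)(N/m₂ + 1)) ≤ 16K·13q`-shaped, precisely `≤ 208·K·q` with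
  `K = Nat.size((2q+2)(m₁+1))` — `O(q log q)` POINTWISE for every pair `a, b`, every class;
  `unionTotal_digitBox_le`; and the `n = 3` law for third curves whose level sets are fitting digit boxes (`≤ k` values):
  `classVert ≤ 208kKq`, **`totalVert ≤ 208kKq²`** (`classVert_le_of_digitBox_levels`, `totalVert_le_of_digitBox_levels`).
APPENDED (same seat): `unionVert_digitBox_le_wrap` (no fitting hypothesis: `≤ 16K(5q + 2m₁N)`, linear in the wrap count `m₁N/q`) and
TWO-STEP BOHR SETS `{t + id₁ + jd₂}` with `d₂` a unit (`bohrTwo`, `bohrTwo_eq_image_digitBox`: image of a digit box with `N = (d₁d₂⁻¹).val`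
under `z ↦ zd₂`; **`unionVert_bohrTwo_le`**: `≤ 16K(5q + 2m₁N)` via `…UnionCosets.unionVert_comp_addEquiv`).
Honest label: a stratum theorem up to `log`; `UnionTotalsLaw C`, `TotalsLawThree C` remain OPEN and are asserted nowhere; nothing here bears
on VP ≠ VNP.
[folklore]
-/

set_option linter.dupNamespace false -- `ValiantsHypothesis.ValiantsHypothesis` (summit = problem) in every name

open Matrix Finset
open scoped BigOperators Pointwise

namespace Summit.ValiantsHypothesis.ValiantsHypothesis.Theorems.NewtonUnitEquationsDissociatedUniform

namespace TotalsLaw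

open Literature.Computability.AlgebraicComplexity.KPTT.PlanarMinkowski

section DigitBox

variable {q : ℕ} [NeZero q]

/-- The DIGIT BOX `{t + i·N + j : i < m₁, j < m₂}` of `ℤ/q` (an arithmetic progression of `m₁` intervals of length `m₂`, step `N`). -/
def digitBox (q t N m₁ m₂ : ℕ) : Finset (ZMod q) :=
  (Finset.range m₁ ×ˢ Finset.range m₂).image fun ij : ℕ × ℕ => ((t + ij.1 * N + ij.2 : ℕ) : ZMod q)

/-- The corner code of the translate `x` in class `s`: `u = (s − x − t − (m₁−1)N − (m₂−1)).val`, so that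
`s − x − y ∈ Z ⟺ y = u + iN + j` with `i < m₁`, `j < m₂` (indices reflected). -/
def boxCorner (t N m₁ m₂ : ℕ) (s x : ZMod q) : ℕ := (s - x - ((t + (m₁ - 1) * N + (m₂ - 1) : ℕ) : ZMod q)).val

/-- `boxCorner < q`. [folklore] -/
theorem boxCorner_lt (t N m₁ m₂ : ℕ) (s x : ZMod q) : boxCorner t N m₁ m₂ s x < q := ZMod.val_lt _

/-- **Digit-box membership as a two-dimensional window** (indices reflected): `s − x − y ∈ Z` iff `y` is the residue of
`n₁ N + n₂` with `(n₁, n₂)` in the box window of shape `m₁ × m₂` cornered at `(u / N, u mod N)`, `u = boxCorner`. [folklore] -/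
theorem mem_digitBox_iff_window (t N m₁ m₂ : ℕ) (s x y : ZMod q) :
    s - x - y ∈ digitBox q t N m₁ m₂ ↔ ∃ n : ℕ × ℕ,
      (boxCorner t N m₁ m₂ s x / N ≤ n.1 ∧ n.1 < boxCorner t N m₁ m₂ s x / N + m₁) ∧
      (boxCorner t N m₁ m₂ s x % N ≤ n.2 ∧ n.2 < boxCorner t N m₁ m₂ s x % N + m₂) ∧
      ((n.1 * N + n.2 : ℕ) : ZMod q) = y := by
  set u := boxCorner t N m₁ m₂ s x with hu
  have hu' : ((u : ℕ) : ZMod q) = s - x - ((t + (m₁ - 1) * N + (m₂ - 1) : ℕ) : ZMod q) := by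
    rw [hu]; unfold boxCorner; exact ZMod.natCast_zmod_val _
  have hdm : N * (u / N) + u % N = u := Nat.div_add_mod u N
  constructor
  · intro hZ
    rw [digitBox, Finset.mem_image] at hZ
    obtain ⟨⟨i, j⟩, hij, hy⟩ := hZ
    rw [Finset.mem_product, Finset.mem_range, Finset.mem_range] at hij
    obtain ⟨hi, hj⟩ := hij
    simp only at hy
    refine ⟨(u / N + (m₁ - 1 - i), u % N + (m₂ - 1 - j)), ⟨Nat.le_add_right _ _, by omega⟩,
      ⟨Nat.le_add_right _ _, by omega⟩, ?_⟩
    -- `y = s − x − (t + iN + j) = u + (m₁−1−i)N + (m₂−1−j)`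
    have hy' : y = s - x - ((t + i * N + j : ℕ) : ZMod q) := by rw [hy]; abel
    have hnat : (u / N + (m₁ - 1 - i)) * N + (u % N + (m₂ - 1 - j)) + (t + i * N + j) =
        u + (t + (m₁ - 1) * N + (m₂ - 1)) := by
      have h1 : (m₁ - 1 - i) * N + i * N = (m₁ - 1) * N := by rw [← Nat.add_mul]; congr 1; omega
      have h2 : m₂ - 1 - j + j = m₂ - 1 := by omega
      have h3 : (u / N + (m₁ - 1 - i)) * N = N * (u / N) + (m₁ - 1 - i) * N := by ring
      rw [h3]
      omega
    rw [hy', eq_sub_iff_add_eq, ← Nat.cast_add, hnat, Nat.cast_add, hu']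
    abel
  · rintro ⟨⟨n₁, n₂⟩, ⟨h1a, h1b⟩, ⟨h2a, h2b⟩, rfl⟩
    simp only at h1a h1b h2a h2b
    rw [digitBox, Finset.mem_image]
    refine ⟨(m₁ - 1 - (n₁ - u / N), m₂ - 1 - (n₂ - u % N)), Finset.mem_product.2
      ⟨Finset.mem_range.2 (by omega), Finset.mem_range.2 (by omega)⟩, ?_⟩
    simp only
    have hnat : (t + (m₁ - 1 - (n₁ - u / N)) * N + (m₂ - 1 - (n₂ - u % N))) + (n₁ * N + n₂) =
        u + (t + (m₁ - 1) * N + (m₂ - 1)) := by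
      have h1 : (m₁ - 1 - (n₁ - u / N)) * N + (n₁ - u / N) * N = (m₁ - 1) * N := by
        rw [← Nat.add_mul]; congr 1; omega
      have h2 : m₂ - 1 - (n₂ - u % N) + (n₂ - u % N) = m₂ - 1 := by omega
      have h3 : n₁ * N = N * (u / N) + (n₁ - u / N) * N := by
        rw [Nat.mul_comm N (u / N), ← Nat.add_mul]; congr 1; omega
      have e2 : n₂ = u % N + (n₂ - u % N) := by omega
      rw [h3]
      omega
    rw [eq_sub_iff_add_eq, ← Nat.cast_add, hnat, Nat.cast_add, hu']
    abel

/-- **The fibre union over a fitting digit box is a union of translated box windows** of the doubly indexed family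
`(n₁, n₂) ↦ b (n₁ N + n₂)`. [folklore] -/
theorem unionPts_digitBox_eq (a b : ZMod q → (Fin 2 → ℝ)) (t N m₁ m₂ : ℕ) (s : ZMod q) :
    unionPts a b (digitBox q t N m₁ m₂ : Set (ZMod q)) s =
      ⋃ x : ZMod q, (a x +ᵥ ((fun n : ℕ × ℕ => b ((n.1 * N + n.2 : ℕ) : ZMod q)) ''
        (Set.Ico (boxCorner t N m₁ m₂ s x / N) (boxCorner t N m₁ m₂ s x / N + m₁) ×ˢ
          Set.Ico (boxCorner t N m₁ m₂ s x % N) (boxCorner t N m₁ m₂ s x % N + m₂)))) := by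
  ext p
  rw [mem_unionPts]; simp only [Set.mem_iUnion]
  constructor
  · rintro ⟨x, y, hZ, rfl⟩
    rw [Finset.mem_coe, mem_digitBox_iff_window t N m₁ m₂] at hZ
    obtain ⟨n, h1, h2, hy⟩ := hZ
    refine ⟨x, ?_⟩
    rw [Set.mem_vadd_set]
    exact ⟨b y, ⟨n, ⟨h1, h2⟩, by simp only; rw [hy]⟩, vadd_eq_add _ _⟩
  · rintro ⟨x, hp⟩
    rw [Set.mem_vadd_set] at hp
    obtain ⟨z, ⟨n, ⟨h1, h2⟩, rfl⟩, rfl⟩ := hp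
    refine ⟨x, ((n.1 * N + n.2 : ℕ) : ZMod q), ?_, vadd_eq_add _ _⟩
    rw [Finset.mem_coe, mem_digitBox_iff_window t N m₁ m₂]
    exact ⟨n, h1, h2, rfl⟩

/-- **THE DIGIT-BOX UNION BOUND, pointwise, up to `log`:** for a fitting digit box (`1 ≤ m₂ ≤ N`, `1 ≤ m₁`, `m₁ N ≤ q`) and ALL
`a b : ℤ/q → ℝ²`, `#vert conv U_s(Z) ≤ 208 · Nat.size((2q+2)(m₁+1)) · q`. [folklore] -/
theorem unionVert_digitBox_le (a b : ZMod q → (Fin 2 → ℝ)) (t N m₁ m₂ : ℕ) (hm₁ : 0 < m₁) (hm₂ : 0 < m₂) (hm₂N : m₂ ≤ N)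
    (hfit : m₁ * N ≤ q) (s : ZMod q) :
    unionVert a b (digitBox q t N m₁ m₂ : Set (ZMod q)) s ≤ 208 * Nat.size ((2 * q + 2) * (m₁ + 1)) * q := by
  have hN : 0 < N := lt_of_lt_of_le hm₂ hm₂N
  have hq : 0 < q := Nat.pos_of_ne_zero (NeZero.ne q)
  unfold unionVert
  rw [unionPts_digitBox_eq a b t N m₁ m₂ s]
  have h := BoxWin.ncard_extremePoints_boxWindows_le (fun n : ℕ × ℕ => b ((n.1 * N + n.2 : ℕ) : ZMod q)) a
    (fun x : ZMod q => boxCorner t N m₁ m₂ s x / N) (fun x => boxCorner t N m₁ m₂ s x % N) hm₁ hm₂ (q / N + 1) N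
    (fun x => Nat.lt_succ_of_le (Nat.div_le_div_right (boxCorner_lt t N m₁ m₂ s x).le))
    (fun x => Nat.mod_lt _ hN)
  rw [ZMod.card] at h
  refine h.trans ?_
  -- the area term: `m₁m₂((q/N+1)/m₁+1)(N/m₂+1) ≤ ((q/N+1) + m₁)(N + m₂) ≤ 12 q`
  set K := Nat.size ((2 * q + 2) * (m₁ + 1))
  have h1 : m₁ * ((q / N + 1) / m₁ + 1) ≤ q / N + 1 + m₁ := by
    have := Nat.mul_div_le (q / N + 1) m₁; rw [Nat.mul_comm] at this; nlinarith
  have h2 : m₂ * (N / m₂ + 1) ≤ 2 * N := by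
    have := Nat.mul_div_le N m₂; rw [Nat.mul_comm] at this; nlinarith
  have h3 : (q / N + 1 + m₁) * N ≤ 3 * q := by
    have e1 : q / N * N ≤ q := Nat.div_mul_le_self q N
    have e2 : N ≤ q := le_trans (by nlinarith : N ≤ m₁ * N) hfit
    nlinarith
  have harea : m₁ * m₂ * (((q / N + 1) / m₁ + 1) * (N / m₂ + 1)) ≤ 6 * q := by
    calc m₁ * m₂ * (((q / N + 1) / m₁ + 1) * (N / m₂ + 1))
        = (m₁ * ((q / N + 1) / m₁ + 1)) * (m₂ * (N / m₂ + 1)) := by ring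
      _ ≤ (q / N + 1 + m₁) * (2 * N) := Nat.mul_le_mul h1 h2
      _ = 2 * ((q / N + 1 + m₁) * N) := by ring
      _ ≤ 2 * (3 * q) := Nat.mul_le_mul_left 2 h3
      _ = 6 * q := by ring
  calc 16 * K * (q + m₁ * m₂ * (((q / N + 1) / m₁ + 1) * (N / m₂ + 1))) ≤ 16 * K * (q + 6 * q) := by gcongr
    _ ≤ 208 * K * q := by nlinarith

/-- **Digit-box union TOTALS:** `∑_s #vert conv U_s(Z) ≤ 208Kq²`. [folklore] -/
theorem unionTotal_digitBox_le (a b : ZMod q → (Fin 2 → ℝ)) (t N m₁ m₂ : ℕ) (hm₁ : 0 < m₁) (hm₂ : 0 < m₂) (hm₂N : m₂ ≤ N)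
    (hfit : m₁ * N ≤ q) :
    unionTotal a b (digitBox q t N m₁ m₂ : Set (ZMod q)) ≤ 208 * Nat.size ((2 * q + 2) * (m₁ + 1)) * q ^ 2 := by
  unfold unionTotal
  calc ∑ s, unionVert a b (digitBox q t N m₁ m₂ : Set (ZMod q)) s ≤ ∑ _s : ZMod q, 208 * Nat.size ((2 * q + 2) * (m₁ + 1)) * q :=
        Finset.sum_le_sum fun s _ => unionVert_digitBox_le a b t N m₁ m₂ hm₁ hm₂ hm₂N hfit s
    _ = _ := by rw [Finset.sum_const, Finset.card_univ, ZMod.card, smul_eq_mul]; ring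

/-- **The `n = 3` law on third curves with fitting digit-box level sets, pointwise:** `V_s ≤ k · 208 K₀ q`, `K₀ = Nat.size((2q+2)(q+1))`.
[folklore] -/
theorem classVert_le_of_digitBox_levels (a b c : ZMod q → (Fin 2 → ℝ)) [DecidableEq (Fin 2 → ℝ)] (k : ℕ)
    (hk : (Finset.univ.image c).card ≤ k)
    (hbox : ∀ v ∈ Finset.univ.image c, ∃ t N m₁ m₂ : ℕ, 0 < m₁ ∧ 0 < m₂ ∧ m₂ ≤ N ∧ m₁ * N ≤ q ∧
      c ⁻¹' {v} = (digitBox q t N m₁ m₂ : Set (ZMod q))) (s : ZMod q) :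
    classVert a b c s ≤ k * (208 * Nat.size ((2 * q + 2) * (q + 1)) * q) := by
  refine (classVert_le_sum_unionVert a b c s).trans ?_
  calc ∑ v ∈ Finset.univ.image c, unionVert a b (c ⁻¹' {v}) s
      ≤ ∑ _v ∈ Finset.univ.image c, 208 * Nat.size ((2 * q + 2) * (q + 1)) * q :=
        Finset.sum_le_sum fun v hv => by
          obtain ⟨t, N, m₁, m₂, hm₁, hm₂, hm₂N, hfit, h⟩ := hbox v hv
          rw [h]
          refine (unionVert_digitBox_le a b t N m₁ m₂ hm₁ hm₂ hm₂N hfit s).trans ?_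
          have hm₁q : m₁ ≤ q := le_trans (Nat.le_mul_of_pos_right m₁ (lt_of_lt_of_le hm₂ hm₂N)) hfit
          have : Nat.size ((2 * q + 2) * (m₁ + 1)) ≤ Nat.size ((2 * q + 2) * (q + 1)) :=
            Nat.size_le_size (Nat.mul_le_mul_left _ (by omega))
          gcongr
    _ ≤ _ := by rw [Finset.sum_const, smul_eq_mul]; exact Nat.mul_le_mul_right _ hk

/-- **… and in TOTAL:** `T(a,b,c) ≤ k · 208 K₀ · q²` for third curves with `≤ k` values on fitting digit boxes, `a, b` arbitrary.
[folklore] -/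
theorem totalVert_le_of_digitBox_levels (a b c : ZMod q → (Fin 2 → ℝ)) [DecidableEq (Fin 2 → ℝ)] (k : ℕ)
    (hk : (Finset.univ.image c).card ≤ k)
    (hbox : ∀ v ∈ Finset.univ.image c, ∃ t N m₁ m₂ : ℕ, 0 < m₁ ∧ 0 < m₂ ∧ m₂ ≤ N ∧ m₁ * N ≤ q ∧
      c ⁻¹' {v} = (digitBox q t N m₁ m₂ : Set (ZMod q))) :
    totalVert a b c ≤ k * (208 * Nat.size ((2 * q + 2) * (q + 1))) * q ^ 2 := by
  unfold totalVert
  calc ∑ s, classVert a b c s ≤ ∑ _s : ZMod q, k * (208 * Nat.size ((2 * q + 2) * (q + 1)) * q) :=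
        Finset.sum_le_sum fun s _ => classVert_le_of_digitBox_levels a b c k hk hbox s
    _ = _ := by rw [Finset.sum_const, Finset.card_univ, ZMod.card, smul_eq_mul]; ring

/-! ### Appended (t1g17, same seat): wrapping digit boxes and two-step Bohr sets with a unit step -/

/-- **Digit boxes that wrap** (no fitting hypothesis `m₁N ≤ q`; only `1 ≤ m₂ ≤ N ≤ q`, `1 ≤ m₁`):
`#vert conv U_s(Z) ≤ 16K·(5q + 2m₁N)`, `K = Nat.size((2q+2)(m₁+1))` — linear in the wrap count `m₁N/q`. [folklore] -/
theorem unionVert_digitBox_le_wrap (a b : ZMod q → (Fin 2 → ℝ)) (t N m₁ m₂ : ℕ) (hm₁ : 0 < m₁) (hm₂ : 0 < m₂) (hm₂N : m₂ ≤ N)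
    (hNq : N ≤ q) (s : ZMod q) :
    unionVert a b (digitBox q t N m₁ m₂ : Set (ZMod q)) s ≤ 16 * Nat.size ((2 * q + 2) * (m₁ + 1)) * (5 * q + 2 * (m₁ * N)) := by
  have hN : 0 < N := lt_of_lt_of_le hm₂ hm₂N
  unfold unionVert
  rw [unionPts_digitBox_eq a b t N m₁ m₂ s]
  have h := BoxWin.ncard_extremePoints_boxWindows_le (fun n : ℕ × ℕ => b ((n.1 * N + n.2 : ℕ) : ZMod q)) a
    (fun x : ZMod q => boxCorner t N m₁ m₂ s x / N) (fun x => boxCorner t N m₁ m₂ s x % N) hm₁ hm₂ (q / N + 1) N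
    (fun x => Nat.lt_succ_of_le (Nat.div_le_div_right (boxCorner_lt t N m₁ m₂ s x).le))
    (fun x => Nat.mod_lt _ hN)
  rw [ZMod.card] at h
  refine h.trans ?_
  set K := Nat.size ((2 * q + 2) * (m₁ + 1))
  have h1 : m₁ * ((q / N + 1) / m₁ + 1) ≤ q / N + 1 + m₁ := by
    have := Nat.mul_div_le (q / N + 1) m₁; rw [Nat.mul_comm] at this; nlinarith
  have h2 : m₂ * (N / m₂ + 1) ≤ 2 * N := by
    have := Nat.mul_div_le N m₂; rw [Nat.mul_comm] at this; nlinarith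
  have h3 : (q / N + 1 + m₁) * (2 * N) ≤ 4 * q + 2 * (m₁ * N) := by
    have e1 : q / N * N ≤ q := Nat.div_mul_le_self q N
    nlinarith
  have harea : m₁ * m₂ * (((q / N + 1) / m₁ + 1) * (N / m₂ + 1)) ≤ 4 * q + 2 * (m₁ * N) := by
    calc m₁ * m₂ * (((q / N + 1) / m₁ + 1) * (N / m₂ + 1))
        = (m₁ * ((q / N + 1) / m₁ + 1)) * (m₂ * (N / m₂ + 1)) := by ring
      _ ≤ (q / N + 1 + m₁) * (2 * N) := Nat.mul_le_mul h1 h2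
      _ ≤ 4 * q + 2 * (m₁ * N) := h3
  calc 16 * K * (q + m₁ * m₂ * (((q / N + 1) / m₁ + 1) * (N / m₂ + 1))) ≤ 16 * K * (q + (4 * q + 2 * (m₁ * N))) := by gcongr
    _ = 16 * K * (5 * q + 2 * (m₁ * N)) := by ring

/-- The TWO-STEP BOHR SET `{t + i·d₁ + j·d₂ : i < m₁, j < m₂}` of `ℤ/q`. -/
def bohrTwo (q : ℕ) (t d₁ d₂ : ZMod q) (m₁ m₂ : ℕ) : Finset (ZMod q) :=
  (Finset.range m₁ ×ˢ Finset.range m₂).image fun ij : ℕ × ℕ => t + (ij.1 : ZMod q) * d₁ + (ij.2 : ZMod q) * d₂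

/-- A two-step Bohr set whose second step is a UNIT is the image of a digit box under the automorphism `z ↦ z·d₂`, with step
`N = (d₁ d₂⁻¹).val` and offset `t' = (t d₂⁻¹).val`. [folklore] -/
theorem bohrTwo_eq_image_digitBox (t d₁ : ZMod q) (d₂ : (ZMod q)ˣ) (m₁ m₂ : ℕ) :
    (bohrTwo q t d₁ (d₂ : ZMod q) m₁ m₂ : Set (ZMod q)) =
      (AddAut.mulRight d₂) '' (digitBox q (t * (↑d₂⁻¹ : ZMod q)).val ((d₁ * (↑d₂⁻¹ : ZMod q)).val) m₁ m₂ : Set (ZMod q)) := by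
  classical
  ext z
  simp only [bohrTwo, digitBox, Finset.coe_image, Finset.coe_product, Finset.coe_range, Set.mem_image, Set.mem_prod,
    Set.mem_Iio, Prod.exists, AddAut.mulRight_apply]
  constructor
  · rintro ⟨i, j, ⟨hi, hj⟩, rfl⟩
    refine ⟨(((t * (↑d₂⁻¹ : ZMod q)).val + i * (d₁ * (↑d₂⁻¹ : ZMod q)).val + j : ℕ) : ZMod q), ⟨i, j, ⟨hi, hj⟩, rfl⟩, ?_⟩
    push_cast
    rw [ZMod.natCast_zmod_val, ZMod.natCast_zmod_val, add_mul, add_mul, mul_assoc, mul_assoc (i : ZMod q), mul_assoc,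
      Units.inv_mul, mul_one, mul_one]
  · rintro ⟨w, ⟨i, j, ⟨hi, hj⟩, rfl⟩, rfl⟩
    refine ⟨i, j, ⟨hi, hj⟩, ?_⟩
    push_cast
    rw [ZMod.natCast_zmod_val, ZMod.natCast_zmod_val, add_mul, add_mul, mul_assoc, mul_assoc (i : ZMod q), mul_assoc,
      Units.inv_mul, mul_one, mul_one]

/-- **Two-step Bohr sets with a unit step:** for `Z = {t + i d₁ + j d₂}` with `d₂` a unit, `N = (d₁d₂⁻¹).val`, `1 ≤ m₂ ≤ N`, `1 ≤ m₁`: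
`#vert conv U_s(Z) ≤ 16K(5q + 2m₁N)` for all pairs `a, b` and every class (relabel by `z ↦ z d₂`, `…UnionCosets.unionVert_comp_addEquiv`).
[folklore] -/
theorem unionVert_bohrTwo_le (a b : ZMod q → (Fin 2 → ℝ)) (t d₁ : ZMod q) (d₂ : (ZMod q)ˣ) (m₁ m₂ : ℕ) (hm₁ : 0 < m₁) (hm₂ : 0 < m₂)
    (hm₂N : m₂ ≤ (d₁ * (↑d₂⁻¹ : ZMod q)).val) (s : ZMod q) :
    unionVert a b (bohrTwo q t d₁ (d₂ : ZMod q) m₁ m₂ : Set (ZMod q)) s ≤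
      16 * Nat.size ((2 * q + 2) * (m₁ + 1)) * (5 * q + 2 * (m₁ * (d₁ * (↑d₂⁻¹ : ZMod q)).val)) := by
  rw [bohrTwo_eq_image_digitBox t d₁ d₂ m₁ m₂]
  -- `U_s(φ Z)[a,b] = U_{φ⁻¹ s}(Z)[a ∘ φ, b ∘ φ]` with `φ = (· * d₂)`
  have h := unionVert_comp_addEquiv a b (AddAut.mulRight d₂)
    (digitBox q (t * (↑d₂⁻¹ : ZMod q)).val ((d₁ * (↑d₂⁻¹ : ZMod q)).val) m₁ m₂ : Set (ZMod q)) ((AddAut.mulRight d₂).symm s)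
  rw [AddEquiv.apply_symm_apply] at h
  rw [← h]
  exact unionVert_digitBox_le_wrap _ _ _ _ m₁ m₂ hm₁ hm₂ hm₂N (ZMod.val_lt _).le _

end DigitBox

end TotalsLaw

end Summit.ValiantsHypothesis.ValiantsHypothesis.Theorems.NewtonUnitEquationsDissociatedUniform
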